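import Literature.MathematicalPhysics.QuantumFieldTheory.Balaban1983to89.B13GaugeDevices
import Literature.MathematicalPhysics.QuantumFieldTheory.Balaban1983to89.Beta.GaussianIntegral
import Literature.MathematicalPhysics.QuantumFieldTheory.GaussianToolkit

/-!
# `Balaban1983to89.B2Eq228Conditioning` — T. Bałaban, *(Higgs)₂,₃ quantum fields in a finite volume. II. An upper bound*, Commun. Math. Phys. **86** (1982) 555–594 [Balaban1982Higgs2]: the conditional Gaussian integration formula **(2.28)** p. 563, PROVED for the finite-dimensional Gaussian model the print describes — an instance of the typed display `B2.Display228` — with the boundary-bond form **(2.29)**/(2.30) of its shift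

statement-level skeleton of published theorems with citation tags; proofs where landed; nothing here is a claim about the Yang–Mills mass gap

PDF held: `paper:balaban1982-cmp86-higgs23-ii` (doi 10.1007/bf01214890; journal page = PDF page + 554); p. 563 [PDF 9] READ AS
AN IMAGE on the ×2 render `run/shared/lean/pub/pub-balaban/b2b-balaban-ref1/pages/1982-cmp86-higgs23-II/1982-cmp86-higgs23-II-p009-x2.png`.

CITATION HEADER — WHAT IS REPRODUCED.  SKELETON rows **B2.Eq2.28** (`typed-existing (+kernel pieces proved)`: the display
is `…Balaban1983to89.B2.Display228` over the abstract functional carrier `B2.CondSetting`, its completed square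
`B2.completeSquare228` kernel-checked; cited by B13 = [Balaban1988RG2Cluster] p. 12 *"(2.28) [6]"*) and, as a rider, the
members (2.29)/(2.30) of row **B2.Eq2.42** of `run/shared/lean/pub/lit-balaban/SKELETON.md`.  Unit `lit-balaban-p15`
(Phase-2 proof seat p15, generation 2; HOME `run/shared/lean/pub/lit-balaban/`, seat dir `lit-balaban-p15/`); B2 fold owner
r02, second reader r14; referee ref-4.

THE PRINTED TEXT (p. 563, verbatim).  *"A next operation is a calculation of the integral in (2.26). This operation can not
be done on the whole set T₁, as in Chap. I.3, but on some subsets of T₁ only, on which the fields A′, φ′ are small. We will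
integrate each term in the sum on the right side of (2.26) on the set Λ₅, and it will be a conditional integration with
conditioning on Λ₅ᶜ.  Let us recall this operation in a general case. Let Ω be a finite set, Λ ⊂ Ω, and let A be a
positive operator on a space of field configurations on Ω, A_Λ its restriction on Λ. Then we have
  ∫Π_{x∈Ω}dφ(x) exp(−½⟨φ,Aφ⟩) exp(⟨f,φ⟩) F(φ↾_Λ) G(φ↾_{Λᶜ})
    = ∫Π_{x∈Ω}dφ(x) exp(−½⟨φ,Aφ⟩) exp(⟨f,φ⟩) G(φ↾_{Λᶜ}) · ∫dμ_{A_Λ⁻¹}(φ′) F(φ′ − A_Λ⁻¹Aφ↾_{Λᶜ} + A_Λ⁻¹f),   (2.28)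
where dμ_{A_Λ⁻¹} is a probabilistic Gaussian measure with the covariance A_Λ⁻¹.  In our case A is given by the main
quadratic form in the fields A′, φ′, f is obvious, Λ = Λ₅, F = χ′exp(V⁽⁰⁾(Λ₇)), and the function G is the product of the
characteristic functions ζ_{Λ₀}χ_{Λ₋₁∩Λ₅ᶜ}χ₁ and the remaining exponential functions, the rest of the characteristic
functions are estimated by 1. The expression (φ′ − A_Λ⁻¹Aφ↾_{Λᶜ})(x) for vector fields has the form
  A′(x) + Σ_{b∈st(Λ₅)} C⁽⁰⁾_{Λ₅}(x, b₋)A′(b₊),  x ∈ Λ₅,   (2.29)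
and for scalar fields  φ′(x) + Σ_{b∈st(Λ₅)} C⁽⁰⁾_{Λ₅}(B⁽¹⁾; x, b₋)U(B_b⁽¹⁾)φ′(b₊),  x ∈ Λ₅.   (2.30)"*

THE MODEL (finite-dimensional, exactly the printed generality; `B13GaugeDevices` §H is the `f = 0`, two-block special case
written for [II] (2.5)–(2.6)).  `Ω` ↦ a finite type `S`; `Λ ⊂ Ω` ↦ a decidable predicate `p` on `S` (points of `Λ` = the
subtype `In p`, of `Λᶜ` = `Out p`); configurations `φ : S → ℝ`, `dφ = Π_{x∈Ω}dφ(x)` = Lebesgue measure `volume`; the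
positive operator `A : Matrix S S ℝ` (`Matrix.PosDef`), its restriction `A_Λ = blkIn p A` and the blocks `A_{ΛΛᶜ} =
blkMix p A`, `A_{ΛᶜΛᶜ} = blkOut p A`; the source `f : S → ℝ`, `⟨f,φ⟩ = Σ_s f(s)φ(s)`; `F(φ↾_Λ)`, `G(φ↾_{Λᶜ})` ↦ `F₀ (resIn p φ)`,
`G₀ (resOut p φ)` with `F₀ : (Λ → ℝ) → ℝ`, `G₀ : (Λᶜ → ℝ) → ℝ`; `dμ_{A_Λ⁻¹}` ↦ the probability measure `gaussProb (blkIn p A)`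
= Lebesgue measure on `Λ → ℝ` with density `exp(−½⟨φ′, A_Λφ′⟩)/∫exp(−½⟨φ′, A_Λφ′⟩)` (`isProbabilityMeasure_gaussProb`; its
mean is `B13GaugeDevices.gaussMean (blkIn p A)`, `integral_gaussProb`; = Mathlib's `multivariateGaussian 0 A_Λ⁻¹` in
coordinates, `gaussProb_eq_map_multivariateGaussian`); the shift `−A_Λ⁻¹Aφ↾_{Λᶜ} + A_Λ⁻¹f` ↦ literally
`A_Λ⁻¹(f↾_Λ − (A(φ↾_{Λᶜ}))↾_Λ)`, extended by `0` off `Λ` (= `condShift p A f (φ↾_{Λᶜ})`, `model_shift`).  These data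
assemble into the carrier `model p A f F₀ G₀ : B2.CondSetting S` (`gaussInt` = `∫dφ e^{−½⟨φ,Aφ⟩}(·)`, `condInt` =
`∫dμ_{A_Λ⁻¹}(φ′)(·)` on configurations `φ′` on `Λ` extended by `0`).

WHAT IS KERNEL-CHECKED (zero `sorry`, standard axioms).
 §1–§2  the bookkeeping `⟨φ,Aφ⟩ = ⟨x,A_Λx⟩ + ⟨x,A_{ΛΛᶜ}y⟩ + ⟨y,A_{ΛᶜΛ}x⟩ + ⟨y,A_{ΛᶜΛᶜ}y⟩`, `⟨f,φ⟩ = ⟨f↾_Λ,x⟩ + ⟨f↾_{Λᶜ},y⟩`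
        for `φ = (x on Λ, y on Λᶜ)` (`quadForm_glue`, `linForm_glue`), and `∫dφ = ∫dx∫dy` (Mathlib's
        `volume_preserving_piEquivPiSubtypeProd`: `integral_eq_integral_glue`, `integrable_iff_integrable_glue`);
 §3     the probabilistic Gaussian measure `dμ_{M⁻¹}` (`gaussProb`; `integral_gaussProb`, `isProbabilityMeasure_gaussProb`,
        normalisation `gaussNorm_eq` = the tree's `Beta.GaussianIntegral.integral_exp_neg_half_quadForm`); that it IS the
        Gaussian measure of mean `0` and covariance matrix `M⁻¹` in Mathlib's sense — `gaussProb M` = the coordinate image of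
        `ProbabilityTheory.multivariateGaussian 0 M⁻¹` (`gaussProb_eq_map_multivariateGaussian`, through the tree's
        `GaussianToolkit.multivariateGaussian_inv_eq_withDensity`); and the linear
        shift `∫dx e^{−⟨j,x⟩−½⟨x,Mx⟩}Ψ(x) = e^{½⟨j,M⁻¹j⟩}∫dx e^{−½⟨x,Mx⟩}Ψ(x − M⁻¹j)` (= `B13GaugeDevices.integral_linear_shift`;
        `integral_tilt`, `tilt_eq`, `integrable_tilt`);
 §4     at fixed exterior field `y = φ↾_{Λᶜ}`: completion of the square `e^{−½⟨φ,Aφ⟩}e^{⟨f,φ⟩} = e^{c(y)}e^{−⟨j(y),x⟩−½⟨x,A_Λx⟩}`,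
        `j(y) = A_{ΛΛᶜ}y − f↾_Λ` (`weight_mul_source_glue`, = `B2.completeSquare228` exponentiated), whence for EVERY `Ψ`
        `∫dx e^{−½⟨φ,Aφ⟩}e^{⟨f,φ⟩}Ψ(x) = K(y)∫dz e^{−½⟨z,A_Λz⟩}Ψ(z + μ(y))` with the printed shift `μ(y) = A_Λ⁻¹(f↾_Λ − A_{ΛΛᶜ}y)`
        (`integral_section`; `integrable_section_const`);
 §5     **(2.28)**: `integral_conditioning` (explicit form) and **`display228 : B2.Display228 (model p A f F₀ G₀)`** for `A`
        positive definite, `F₀`, `G₀` measurable and the left side absolutely convergent — by Fubini over `(φ↾_Λ, φ↾_{Λᶜ})`,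
        §4, and `∫dμ 1 = 1`; the integrability of the RIGHT side is DERIVED from that of the left side (`integrable_rhs`:
        measurability of the inner integral `measurable_inner`, sections `integrable_section_const`, domination of the
        `y`-marginal through `|∫dμ F(· + μ)|·∫e^{−½⟨z,A_Λz⟩} ≤ ∫e^{−½⟨z,A_Λz⟩}|F(z + μ)|`, `abs_inner_mul_gaussNorm_le`);
 §6     `display228_of_bounded`: all hypotheses discharged for bounded measurable `F₀`, `G₀` (the print's case:
        characteristic functions times bounded exponential factors; `integrable_weight_mul_source`);
 §7     **(2.29)** `display229` (and its general form `shift_eq_sum_boundary`, which with the bond couplings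
        `−A(b₋,b₊) = U(B_b⁽¹⁾)` is (2.30)): if `A` couples `Λ` to `Λᶜ` only through the bonds `b = (b₋, b₊) ∈ st(Λ)` with
        `A(b₋,b₊) = −1`, then `(φ′ − A_Λ⁻¹Aφ↾_{Λᶜ})(x) = φ′(x) + Σ_{b∈st(Λ)} A_Λ⁻¹(x,b₋)φ(b₊)`, `x ∈ Λ` (`C⁽⁰⁾_Λ = A_Λ⁻¹`).
NOT reproduced: the identification, in the (Higgs)₂,₃ run, of `A` with "the main quadratic form in the fields A′, φ′" and
of `F`, `G` with the printed characteristic/exponential functions (rows B2.Eq2.42, (2.20)–(2.27)), and the estimate (2.31).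
-/

open MeasureTheory Matrix Finset
open scoped BigOperators ENNReal

namespace Literature.MathematicalPhysics.QuantumFieldTheory.Balaban1983to89.B2Eq228Conditioning

open B13GaugeDevices (gaussWeight gaussInt gaussNorm gaussMean)

variable {S : Type} [Fintype S] (p : S → Prop) [DecidablePred p]

/-! ## §1 Configurations on `Ω`, on `Λ` and on `Λᶜ`; the blocks of `A` -/

/-- The points of `Λ ⊂ Ω` as a type (configurations on `Λ` are `In p → ℝ`). [cite: Balaban1982Higgs2, (2.28) p.563] -/
abbrev In : Type := {s : S // p s}

/-- The points of `Λᶜ = Ω ∖ Λ` as a type. [cite: Balaban1982Higgs2, (2.28) p.563] -/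
abbrev Out : Type := {s : S // ¬ p s}

/-- `φ↾_Λ`. [cite: Balaban1982Higgs2, (2.28) p.563] -/
def resIn (φ : S → ℝ) : In p → ℝ := fun i => φ i

/-- `φ↾_{Λᶜ}`. [cite: Balaban1982Higgs2, (2.28) p.563] -/
def resOut (φ : S → ℝ) : Out p → ℝ := fun j => φ j

/-- The configuration on `Ω` with prescribed parts on `Λ` and on `Λᶜ`. [cite: Balaban1982Higgs2, (2.28) p.563] -/
def glue (x : In p → ℝ) (y : Out p → ℝ) : S → ℝ :=
  fun s => if h : p s then x ⟨s, h⟩ else y ⟨s, h⟩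

omit [Fintype S] in
/-- On `Λ` the glued configuration is the `Λ`-part. [folklore] [cite: Balaban1982Higgs2, (2.28) p.563] -/
@[simp] theorem glue_apply_in (x : In p → ℝ) (y : Out p → ℝ) (i : In p) :
    glue p x y i = x i := by
  simp [glue, i.2]

omit [Fintype S] in
/-- On `Λᶜ` the glued configuration is the `Λᶜ`-part. [folklore] [cite: Balaban1982Higgs2, (2.28) p.563] -/
@[simp] theorem glue_apply_out (x : In p → ℝ) (y : Out p → ℝ) (j : Out p) :
    glue p x y j = y j := by
  simp [glue, j.2]

omit [Fintype S] in
/-- `(x on Λ, y on Λᶜ)↾_Λ = x`. [folklore] [cite: Balaban1982Higgs2, (2.28) p.563] -/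
@[simp] theorem resIn_glue (x : In p → ℝ) (y : Out p → ℝ) : resIn p (glue p x y) = x := by
  funext i; simp [resIn]

omit [Fintype S] in
/-- `(x on Λ, y on Λᶜ)↾_{Λᶜ} = y`. [folklore] [cite: Balaban1982Higgs2, (2.28) p.563] -/
@[simp] theorem resOut_glue (x : In p → ℝ) (y : Out p → ℝ) : resOut p (glue p x y) = y := by
  funext j; simp [resOut]

omit [Fintype S] in
/-- `φ = (φ↾_Λ on Λ, φ↾_{Λᶜ} on Λᶜ)`. [folklore] [cite: Balaban1982Higgs2, (2.28) p.563] -/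
@[simp] theorem glue_resIn_resOut (φ : S → ℝ) : glue p (resIn p φ) (resOut p φ) = φ := by
  funext s
  by_cases h : p s <;> simp [glue, resIn, resOut, h]

omit [Fintype S] in
/-- Gluing is additive. [folklore] [cite: Balaban1982Higgs2, (2.28) p.563] -/
theorem glue_add (x x' : In p → ℝ) (y y' : Out p → ℝ) :
    glue p (x + x') (y + y') = glue p x y + glue p x' y' := by
  funext s
  by_cases h : p s <;> simp [glue, h]

omit [Fintype S] [DecidablePred p] in
/-- Restriction to `Λ` is additive. [folklore] [cite: Balaban1982Higgs2, (2.28) p.563] -/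
theorem resIn_add (φ φ' : S → ℝ) : resIn p (φ + φ') = resIn p φ + resIn p φ' := rfl

/-- `A_Λ`: the restriction of `A` to `Λ` (print: *"A_Λ its restriction on Λ"*). [cite: Balaban1982Higgs2, (2.28) p.563] -/
def blkIn (A : Matrix S S ℝ) : Matrix (In p) (In p) ℝ := A.submatrix Subtype.val Subtype.val

/-- The `Λ × Λᶜ` block of `A` (through which `φ↾_{Λᶜ}` enters `Aφ↾_{Λᶜ}` on `Λ`). [cite: Balaban1982Higgs2, (2.28) p.563] -/
def blkMix (A : Matrix S S ℝ) : Matrix (In p) (Out p) ℝ := A.submatrix Subtype.val Subtype.val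

/-- The `Λᶜ × Λ` block of `A`. [cite: Balaban1982Higgs2, (2.28) p.563] -/
def blkMix' (A : Matrix S S ℝ) : Matrix (Out p) (In p) ℝ := A.submatrix Subtype.val Subtype.val

/-- The `Λᶜ × Λᶜ` block of `A`. [cite: Balaban1982Higgs2, (2.28) p.563] -/
def blkOut (A : Matrix S S ℝ) : Matrix (Out p) (Out p) ℝ := A.submatrix Subtype.val Subtype.val

omit [Fintype S] [DecidablePred p] in
/-- For symmetric `A` the `Λᶜ × Λ` block is the transpose of the `Λ × Λᶜ` block. [folklore] [cite: Balaban1982Higgs2, (2.28) p.563] -/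
theorem blkMix'_eq_transpose {A : Matrix S S ℝ} (hA : A.IsSymm) :
    blkMix' p A = (blkMix p A)ᵀ := by
  ext j i
  simp only [blkMix', blkMix, submatrix_apply, transpose_apply]
  exact hA.apply i.1 j.1

/-- Splitting a sum over `Ω` into its `Λ` and `Λᶜ` parts. [folklore] [cite: Balaban1982Higgs2, (2.28) p.563] -/
theorem sum_split (g : S → ℝ) :
    ∑ s, g s = ∑ i : In p, g i + ∑ j : Out p, g j :=
  (Fintype.sum_subtype_add_sum_subtype p g).symm

/-- `(Aφ)(i)` for `i ∈ Λ`, in blocks. [folklore] [cite: Balaban1982Higgs2, (2.28) p.563] -/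
theorem mulVec_glue_in (A : Matrix S S ℝ) (x : In p → ℝ) (y : Out p → ℝ) (i : In p) :
    (A *ᵥ glue p x y) i = (blkIn p A *ᵥ x) i + (blkMix p A *ᵥ y) i := by
  simp only [mulVec, dotProduct, blkIn, blkMix, submatrix_apply]
  rw [sum_split p]
  simp

/-- `(Aφ)(j)` for `j ∈ Λᶜ`, in blocks. [folklore] [cite: Balaban1982Higgs2, (2.28) p.563] -/
theorem mulVec_glue_out (A : Matrix S S ℝ) (x : In p → ℝ) (y : Out p → ℝ) (j : Out p) :
    (A *ᵥ glue p x y) j = (blkMix' p A *ᵥ x) j + (blkOut p A *ᵥ y) j := by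
  simp only [mulVec, dotProduct, blkMix', blkOut, submatrix_apply]
  rw [sum_split p]
  simp

/-- `⟨φ, Aφ⟩` in the blocks of `φ = (x on Λ, y on Λᶜ)`. [folklore] [cite: Balaban1982Higgs2, (2.28) p.563] -/
theorem quadForm_glue (A : Matrix S S ℝ) (x : In p → ℝ) (y : Out p → ℝ) :
    glue p x y ⬝ᵥ (A *ᵥ glue p x y)
      = x ⬝ᵥ (blkIn p A *ᵥ x) + x ⬝ᵥ (blkMix p A *ᵥ y) + y ⬝ᵥ (blkMix' p A *ᵥ x) + y ⬝ᵥ (blkOut p A *ᵥ y) := by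
  rw [dotProduct, sum_split p]
  simp only [glue_apply_in, glue_apply_out, mulVec_glue_in, mulVec_glue_out, mul_add, sum_add_distrib]
  simp only [dotProduct]
  ring

/-- `⟨f, φ⟩` in blocks. [folklore] [cite: Balaban1982Higgs2, (2.28) p.563] -/
theorem linForm_glue (f : S → ℝ) (x : In p → ℝ) (y : Out p → ℝ) :
    ∑ s, f s * glue p x y s = resIn p f ⬝ᵥ x + resOut p f ⬝ᵥ y := by
  rw [sum_split p]
  simp [dotProduct, resIn, resOut]

/-! ## §2 Lebesgue measure on `Ω`-configurations = product of the Lebesgue measures on `Λ`- and `Λᶜ`-configurations -/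

/-- The measurable equivalence `(S → ℝ) ≃ᵐ (In p → ℝ) × (Out p → ℝ)` (Mathlib), whose inverse is `glue`. [folklore] [cite: Balaban1982Higgs2, (2.28) p.563] -/
def splitEquiv : (S → ℝ) ≃ᵐ (In p → ℝ) × (Out p → ℝ) :=
  MeasurableEquiv.piEquivPiSubtypeProd (fun _ : S => ℝ) p

omit [Fintype S] in
/-- The inverse of the splitting equivalence is `glue`. [folklore] [cite: Balaban1982Higgs2, (2.28) p.563] -/
theorem splitEquiv_symm_apply (q : (In p → ℝ) × (Out p → ℝ)) :
    (splitEquiv p).symm q = glue p q.1 q.2 := by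
  funext s
  rfl

/-- `glue` pushes the product Lebesgue measure to the Lebesgue measure on `Ω`-configurations (Mathlib's
`volume_preserving_piEquivPiSubtypeProd`). [folklore] [cite: Balaban1982Higgs2, (2.28) p.563] -/
theorem measurePreserving_splitEquiv_symm :
    MeasurePreserving (splitEquiv p).symm volume volume :=
  (volume_preserving_piEquivPiSubtypeProd (fun _ : S => ℝ) p).symm _

/-- Integration over `Ω`-configurations as integration over pairs. [folklore] [cite: Balaban1982Higgs2, (2.28) p.563] -/
theorem integral_eq_integral_glue (g : (S → ℝ) → ℝ) :
    ∫ φ, g φ = ∫ q : (In p → ℝ) × (Out p → ℝ), g (glue p q.1 q.2) := by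
  have h := (measurePreserving_splitEquiv_symm p).integral_comp' (f := (splitEquiv p).symm) g
  simp only [splitEquiv_symm_apply] at h
  exact h.symm

/-- Integrability over `Ω`-configurations as integrability over pairs. [folklore] [cite: Balaban1982Higgs2, (2.28) p.563] -/
theorem integrable_iff_integrable_glue (g : (S → ℝ) → ℝ) :
    Integrable g ↔ Integrable (fun q : (In p → ℝ) × (Out p → ℝ) => g (glue p q.1 q.2)) := by
  have h := (measurePreserving_splitEquiv_symm p).integrable_comp_emb (splitEquiv p).symm.measurableEmbedding
    (g := g)
  rw [← h]
  simp only [Function.comp_def, splitEquiv_symm_apply]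


/-! ## §3 The probabilistic Gaussian measure `dμ_{M⁻¹}` with covariance `M⁻¹` (normalised weight `e^{−½⟨x,Mx⟩}`) -/

section GaussProb

variable {ι : Type} [Fintype ι]

/-- `gaussWeight M x = exp(−½ xᵀMx)` in the normal form of `Beta.GaussianIntegral`. [folklore] [cite: Balaban1982Higgs2, (2.28) p.563] -/
theorem gaussWeight_eq (M : Matrix ι ι ℝ) (x : ι → ℝ) :
    gaussWeight M x = Real.exp (-(1/2 : ℝ) * (x ⬝ᵥ M *ᵥ x)) := by
  unfold gaussWeight
  congr 1
  ring

/-- The Gaussian weight is positive. [folklore] [cite: Balaban1982Higgs2, (2.28) p.563] -/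
theorem gaussWeight_pos (M : Matrix ι ι ℝ) (x : ι → ℝ) : 0 < gaussWeight M x := Real.exp_pos _

/-- The Gaussian weight `x ↦ exp(−½⟨x, Mx⟩)`, as a real function on `ι → ℝ`, is measurable (it is continuous).
[folklore] [cite: Balaban1982Higgs2, (2.28) p.563] -/
theorem measurable_gaussWeight_real (M : Matrix ι ι ℝ) :
    Measurable (fun x : ι → ℝ => Real.exp (-(1 / 2 * (x ⬝ᵥ (M *ᵥ x))))) := by
  refine Continuous.measurable ?_
  fun_prop

/-- The weight of a positive definite `M` is integrable. [folklore] [cite: Balaban1982Higgs2, (2.28) p.563] -/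
theorem integrable_gaussWeight [DecidableEq ι] {M : Matrix ι ι ℝ} (hM : M.PosDef) : Integrable (gaussWeight M) := by
  have h := Beta.GaussianIntegral.integrable_exp_neg_half_quadForm M hM
  refine h.congr (Filter.Eventually.of_forall fun x => ?_)
  exact (gaussWeight_eq M x).symm

/-- The normalisation of a positive definite `M` is `√(2π)^{|ι|}/√(det M) > 0`. [folklore] [cite: Balaban1982Higgs2, (2.28) p.563] -/
theorem gaussNorm_eq [DecidableEq ι] {M : Matrix ι ι ℝ} (hM : M.PosDef) :
    gaussNorm M = Real.sqrt (2 * Real.pi) ^ Fintype.card ι / Real.sqrt M.det := by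
  rw [← Beta.GaussianIntegral.integral_exp_neg_half_quadForm M hM, gaussNorm]
  exact integral_congr_ae (Filter.Eventually.of_forall fun x => gaussWeight_eq M x)

/-- The normalisation of a positive definite `M` is positive. [folklore] [cite: Balaban1982Higgs2, (2.28) p.563] -/
theorem gaussNorm_pos [DecidableEq ι] {M : Matrix ι ι ℝ} (hM : M.PosDef) : 0 < gaussNorm M := by
  rw [gaussNorm_eq hM]
  have h1 : 0 < Real.sqrt (2 * Real.pi) := Real.sqrt_pos.2 (by positivity)
  have h2 : 0 < Real.sqrt M.det := Real.sqrt_pos.2 hM.det_pos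
  positivity

/-- The normalisation is non-negative (junk `0` included). [folklore] [cite: Balaban1982Higgs2, (2.28) p.563] -/
theorem gaussNorm_nonneg (M : Matrix ι ι ℝ) : 0 ≤ gaussNorm M :=
  integral_nonneg fun x => (gaussWeight_pos M x).le

/-- **`dμ_{M⁻¹}`**: the probabilistic Gaussian measure on `ι → ℝ` with covariance `M⁻¹`, i.e. Lebesgue measure with the
density `exp(−½⟨x,Mx⟩)` normalised by `∫dx exp(−½⟨x,Mx⟩)` (print: *"dμ_{A_Λ⁻¹} is a probabilistic Gaussian measure with
the covariance A_Λ⁻¹"*, `M = A_Λ`). [cite: Balaban1982Higgs2, (2.28) p.563] -/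
noncomputable def gaussProb (M : Matrix ι ι ℝ) : Measure (ι → ℝ) :=
  ENNReal.ofReal (gaussNorm M)⁻¹ • volume.withDensity (fun x => ENNReal.ofReal (gaussWeight M x))

/-- Integration against `dμ_{M⁻¹}` is the normalised Gaussian mean of `B13GaugeDevices` (for every integrand; both
sides are the same junk when `M` is degenerate). [cite: Balaban1982Higgs2, (2.28) p.563] -/
theorem integral_gaussProb (M : Matrix ι ι ℝ) (h : (ι → ℝ) → ℝ) :
    ∫ x, h x ∂(gaussProb M) = gaussMean M h := by
  have hm : Measurable fun x : ι → ℝ => ENNReal.ofReal (gaussWeight M x) :=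
    (measurable_gaussWeight_real M).ennreal_ofReal
  rw [gaussProb, integral_smul_measure, integral_withDensity_eq_integral_toReal_smul hm
    (Filter.Eventually.of_forall fun _ => ENNReal.ofReal_lt_top)]
  rw [ENNReal.toReal_ofReal (inv_nonneg.2 (gaussNorm_nonneg M))]
  simp only [gaussMean, gaussInt, smul_eq_mul]
  congr 1
  refine integral_congr_ae (Filter.Eventually.of_forall fun x => ?_)
  simp only [ENNReal.toReal_ofReal (gaussWeight_pos M x).le]

/-- `dμ_{M⁻¹}` is a probability measure (`M` positive definite). [cite: Balaban1982Higgs2, (2.28) p.563] -/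
theorem isProbabilityMeasure_gaussProb [DecidableEq ι] {M : Matrix ι ι ℝ} (hM : M.PosDef) :
    IsProbabilityMeasure (gaussProb M) := by
  constructor
  rw [gaussProb, Measure.smul_apply, withDensity_apply _ MeasurableSet.univ, Measure.restrict_univ,
    ← ofReal_integral_eq_lintegral_ofReal (integrable_gaussWeight hM)
      (Filter.Eventually.of_forall fun x => (gaussWeight_pos M x).le),
    smul_eq_mul, ← ENNReal.ofReal_mul (inv_nonneg.2 (gaussNorm_nonneg M))]
  have : (gaussNorm M)⁻¹ * ∫ x, gaussWeight M x = 1 := inv_mul_cancel₀ (gaussNorm_pos hM).ne'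
  rw [this, ENNReal.ofReal_one]

/-- **`dμ_{M⁻¹}` is the Gaussian measure with mean `0` and covariance matrix `M⁻¹`** in Mathlib's sense: for `M`
positive definite, `gaussProb M` is the image, under the coordinate map `EuclideanSpace ℝ ι → (ι → ℝ)`, of
`ProbabilityTheory.multivariateGaussian 0 M⁻¹` — the print's *"probabilistic Gaussian measure with the covariance
A_Λ⁻¹"* read literally (via the tree's `GaussianToolkit.multivariateGaussian_inv_eq_withDensity`).
[cite: Balaban1982Higgs2, (2.28) p.563] -/
theorem gaussProb_eq_map_multivariateGaussian [DecidableEq ι] {M : Matrix ι ι ℝ} (hM : M.PosDef) :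
    gaussProb M
      = (ProbabilityTheory.multivariateGaussian 0 M⁻¹).map ⇑(MeasurableEquiv.toLp 2 (ι → ℝ)).symm := by
  obtain ⟨hmg, -, -⟩ := GaussianToolkit.multivariateGaussian_inv_eq_withDensity hM
  rw [hmg, Measure.map_smul, GaussianToolkit.map_withDensity_equiv,
    (EuclideanSpace.volume_preserving_symm_measurableEquiv_toLp ι).map_eq]
  have hdens : (GaussianToolkit.gaussWeight M ∘ ⇑(MeasurableEquiv.toLp 2 (ι → ℝ)).symm.symm)
      = fun x : ι → ℝ => ENNReal.ofReal (gaussWeight M x) := by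
    funext x
    simp only [Function.comp_apply, MeasurableEquiv.symm_symm, MeasurableEquiv.coe_toLp,
      GaussianToolkit.gaussWeight, gaussWeight]
    congr 2
    ring
  have hZ : GaussianToolkit.gaussZ M = ENNReal.ofReal (gaussNorm M) := by
    unfold GaussianToolkit.gaussZ
    rw [← (PiLp.volume_preserving_toLp ι).lintegral_comp (GaussianToolkit.measurable_gaussWeight M)]
    have h2 : (fun x : ι → ℝ => GaussianToolkit.gaussWeight M (WithLp.toLp 2 x))
        = fun x => ENNReal.ofReal (gaussWeight M x) := by
      funext x
      simp only [GaussianToolkit.gaussWeight, gaussWeight]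
      congr 2
      ring
    rw [h2, ← ofReal_integral_eq_lintegral_ofReal (integrable_gaussWeight hM)
      (Filter.Eventually.of_forall fun x => (gaussWeight_pos M x).le)]
    rfl
  rw [hdens, hZ, gaussProb, ENNReal.ofReal_inv_of_pos (gaussNorm_pos hM)]

/-- The mean of `dμ_{M⁻¹}` written out: `∫dμ_{M⁻¹} h = [∫dx e^{−½⟨x,Mx⟩}]⁻¹ ∫dx e^{−½⟨x,Mx⟩} h(x)`.
[cite: Balaban1982Higgs2, (2.28) p.563] -/
theorem integral_gaussProb_eq (M : Matrix ι ι ℝ) (h : (ι → ℝ) → ℝ) :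
    ∫ x, h x ∂(gaussProb M) = (gaussNorm M)⁻¹ * ∫ x, gaussWeight M x * h x := by
  rw [integral_gaussProb]
  simp [gaussMean, gaussInt]

variable [DecidableEq ι]

/-- **The linear shift** (translation invariance of `dx`), `B13GaugeDevices.integral_linear_shift` in product form:
`∫dx e^{−⟨j,x⟩−½⟨x,Mx⟩}Ψ(x) = e^{½⟨j,M⁻¹j⟩}∫dx e^{−½⟨x,Mx⟩}Ψ(x − M⁻¹j)` — no hypothesis on `Ψ`. [folklore] [cite: Balaban1982Higgs2, (2.28) p.563] -/
theorem integral_tilt (M : Matrix ι ι ℝ) (hM : M.IsSymm) (hdet : IsUnit M.det) (j : ι → ℝ) (Ψ : (ι → ℝ) → ℝ) :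
    ∫ x, Real.exp (-(j ⬝ᵥ x) - 1 / 2 * (x ⬝ᵥ (M *ᵥ x))) * Ψ x
      = Real.exp (1 / 2 * (j ⬝ᵥ (M⁻¹ *ᵥ j))) * gaussInt M (fun z => Ψ (z - M⁻¹ *ᵥ j)) := by
  have h := B13GaugeDevices.integral_linear_shift M hM hdet j Ψ
  simpa only [smul_eq_mul] using h

/-- The tilted weight is a translated Gaussian weight: `e^{−⟨j,x⟩−½⟨x,Mx⟩} = e^{½⟨j,M⁻¹j⟩}e^{−½⟨x+M⁻¹j, M(x+M⁻¹j)⟩}`.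
[folklore] [cite: Balaban1982Higgs2, (2.28) p.563] -/
theorem tilt_eq (M : Matrix ι ι ℝ) (hM : M.IsSymm) (hdet : IsUnit M.det) (j x : ι → ℝ) :
    Real.exp (-(j ⬝ᵥ x) - 1 / 2 * (x ⬝ᵥ (M *ᵥ x)))
      = Real.exp (1 / 2 * (j ⬝ᵥ (M⁻¹ *ᵥ j))) * gaussWeight M (x + M⁻¹ *ᵥ j) := by
  set m : ι → ℝ := M⁻¹ *ᵥ j with hm
  have hMm : M *ᵥ m = j := by rw [hm, mulVec_mulVec, mul_nonsing_inv _ hdet, one_mulVec]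
  rw [gaussWeight, ← Real.exp_add]
  congr 1
  have h1 : (x + m) ⬝ᵥ (M *ᵥ (x + m)) = x ⬝ᵥ (M *ᵥ x) + x ⬝ᵥ (M *ᵥ m) + (m ⬝ᵥ (M *ᵥ x) + m ⬝ᵥ (M *ᵥ m)) := by
    rw [mulVec_add, add_dotProduct, dotProduct_add, dotProduct_add]
  have h2 : m ⬝ᵥ (M *ᵥ x) = x ⬝ᵥ (M *ᵥ m) := by
    have := dotProduct_transpose_mulVec M m x
    rwa [hM.eq] at this
  rw [h1, h2, hMm, dotProduct_comm x j, dotProduct_comm m j]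
  ring

/-- Integrability of the tilted weight. [folklore] [cite: Balaban1982Higgs2, (2.28) p.563] -/
theorem integrable_tilt {M : Matrix ι ι ℝ} (hM : M.PosDef) (j : ι → ℝ) :
    Integrable (fun x => Real.exp (-(j ⬝ᵥ x) - 1 / 2 * (x ⬝ᵥ (M *ᵥ x)))) := by
  have hMs : M.IsSymm := by
    have h := hM.isHermitian.eq
    rwa [conjTranspose_eq_transpose_of_trivial] at h
  have hdet : IsUnit M.det := isUnit_iff_ne_zero.2 hM.det_pos.ne'
  simp_rw [tilt_eq M hMs hdet j]
  exact ((integrable_gaussWeight hM).comp_add_right (M⁻¹ *ᵥ j)).const_mul _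

end GaussProb

/-! ## §4 The `Ω`-model at fixed exterior field `φ↾_{Λᶜ} = y`: completing the square and the linear shift -/

section Conditioning

variable (A : Matrix S S ℝ) (f : S → ℝ)

/-- `exp(−½⟨φ, Aφ⟩)`: the Gaussian weight of `∫Π_{x∈Ω}dφ(x) exp(−½⟨φ,Aφ⟩)(·)`. [cite: Balaban1982Higgs2, (2.28) p.563] -/
noncomputable def weight (φ : S → ℝ) : ℝ := Real.exp (-(1/2 : ℝ) * (φ ⬝ᵥ A *ᵥ φ))

/-- `exp(⟨f, φ⟩)`: the source factor. [cite: Balaban1982Higgs2, (2.28) p.563] -/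
noncomputable def source (φ : S → ℝ) : ℝ := Real.exp (∑ s, f s * φ s)

omit [DecidablePred p] in
/-- The weight is positive. [folklore] [cite: Balaban1982Higgs2, (2.28) p.563] -/
theorem weight_pos (φ : S → ℝ) : 0 < weight A φ := Real.exp_pos _

omit [DecidablePred p] in
/-- The source factor is positive. [folklore] [cite: Balaban1982Higgs2, (2.28) p.563] -/
theorem source_pos (φ : S → ℝ) : 0 < source f φ := Real.exp_pos _

omit [DecidablePred p] in
/-- The weight is continuous. [folklore] [cite: Balaban1982Higgs2, (2.28) p.563] -/
theorem continuous_weight : Continuous (weight A) := by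
  unfold weight
  fun_prop

omit [DecidablePred p] in
/-- The source factor is continuous. [folklore] [cite: Balaban1982Higgs2, (2.28) p.563] -/
theorem continuous_source : Continuous (source f) := by
  unfold source
  fun_prop

/-- The linear source seen by the `Λ`-integration at exterior field `y`: `j(y) = A_{ΛΛᶜ}y − f↾_Λ`. [folklore] [cite: Balaban1982Higgs2, (2.28) p.563] -/
noncomputable def jIn (y : Out p → ℝ) : In p → ℝ := blkMix p A *ᵥ y - resIn p f

/-- The part of the exponent not involving the `Λ`-field: `c(y) = −½⟨y, A_{ΛᶜΛᶜ}y⟩ + ⟨f↾_{Λᶜ}, y⟩`. [folklore] [cite: Balaban1982Higgs2, (2.28) p.563] -/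
noncomputable def cOut (y : Out p → ℝ) : ℝ := -(1/2 : ℝ) * (y ⬝ᵥ blkOut p A *ᵥ y) + resOut p f ⬝ᵥ y

/-- **Completing the square at fixed exterior field** (`B2.completeSquare228` in exponential form): for symmetric `A`,
`e^{−½⟨φ,Aφ⟩}e^{⟨f,φ⟩} = e^{c(y)} · e^{−⟨j(y),x⟩ − ½⟨x,A_Λx⟩}` for `φ = (x on Λ, y on Λᶜ)`. [folklore] [cite: Balaban1982Higgs2, (2.28) p.563] -/
theorem weight_mul_source_glue (hA : A.IsSymm) (x : In p → ℝ) (y : Out p → ℝ) :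
    weight A (glue p x y) * source f (glue p x y)
      = Real.exp (cOut p A f y) * Real.exp (-(jIn p A f y ⬝ᵥ x) - 1 / 2 * (x ⬝ᵥ (blkIn p A *ᵥ x))) := by
  rw [weight, source, quadForm_glue, linForm_glue, blkMix'_eq_transpose p hA, ← Real.exp_add, ← Real.exp_add]
  congr 1
  rw [cOut, jIn, Matrix.dotProduct_transpose_mulVec (blkMix p A) y x, sub_dotProduct,
    dotProduct_comm (blkMix p A *ᵥ y) x]
  ring

variable [DecidableEq S]

/-- **The printed shift**, as a configuration on `Λ`, at exterior field `y = φ↾_{Λᶜ}`: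
`−A_Λ⁻¹(Aφ↾_{Λᶜ}) + A_Λ⁻¹f = A_Λ⁻¹(f↾_Λ − A_{ΛΛᶜ}y)` (the conditional mean of `φ↾_Λ` plus the source drift).
[cite: Balaban1982Higgs2, (2.28) p.563] -/
noncomputable def condShift (y : Out p → ℝ) : In p → ℝ := (blkIn p A)⁻¹ *ᵥ (resIn p f - blkMix p A *ᵥ y)

/-- The `y`-dependent constant produced by the `Λ`-integration: `K(y) = e^{c(y)} e^{½⟨j(y), A_Λ⁻¹j(y)⟩}`. [folklore] [cite: Balaban1982Higgs2, (2.28) p.563] -/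
noncomputable def secConst (y : Out p → ℝ) : ℝ :=
  Real.exp (cOut p A f y) * Real.exp (1 / 2 * (jIn p A f y ⬝ᵥ ((blkIn p A)⁻¹ *ᵥ jIn p A f y)))

/-- The shift is `−A_Λ⁻¹j(y)`. [folklore] [cite: Balaban1982Higgs2, (2.28) p.563] -/
theorem condShift_eq_neg (y : Out p → ℝ) : condShift p A f y = -((blkIn p A)⁻¹ *ᵥ jIn p A f y) := by
  rw [condShift, jIn, ← mulVec_neg, neg_sub]

/-- The shift depends continuously on the exterior field. [folklore] [cite: Balaban1982Higgs2, (2.28) p.563] -/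
theorem continuous_condShift : Continuous (condShift p A f) := by
  unfold condShift
  fun_prop

/-- `K(y) > 0`. [folklore] [cite: Balaban1982Higgs2, (2.28) p.563] -/
theorem secConst_pos (y : Out p → ℝ) : 0 < secConst p A f y := mul_pos (Real.exp_pos _) (Real.exp_pos _)

/-- **The `Λ`-integration at fixed exterior field** (no hypothesis on the integrand `Ψ`): for symmetric `A` with `A_Λ`
invertible, `∫dx e^{−½⟨φ,Aφ⟩}e^{⟨f,φ⟩}Ψ(x)c = c·K(y)·∫dz e^{−½⟨z,A_Λz⟩}Ψ(z + μ(y))`, `μ(y)` the printed shift.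
[cite: Balaban1982Higgs2, (2.28) p.563] -/
theorem integral_section (hA : A.IsSymm) (hdet : IsUnit (blkIn p A).det) (y : Out p → ℝ)
    (Ψ : (In p → ℝ) → ℝ) (c : ℝ) :
    ∫ x, weight A (glue p x y) * (source f (glue p x y) * Ψ x * c)
      = c * secConst p A f y * gaussInt (blkIn p A) (fun z => Ψ (z + condShift p A f y)) := by
  have hpt : ∀ x, weight A (glue p x y) * (source f (glue p x y) * Ψ x * c)
      = (c * Real.exp (cOut p A f y))
        * (Real.exp (-(jIn p A f y ⬝ᵥ x) - 1 / 2 * (x ⬝ᵥ (blkIn p A *ᵥ x))) * Ψ x) := by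
    intro x
    have h := weight_mul_source_glue p A f hA x y
    calc weight A (glue p x y) * (source f (glue p x y) * Ψ x * c)
        = (weight A (glue p x y) * source f (glue p x y)) * Ψ x * c := by ring
      _ = _ := by rw [h]; ring
  have hAs : (blkIn p A).IsSymm := by
    ext i j
    simp only [blkIn, submatrix_apply, transpose_apply]
    exact hA.apply i.1 j.1
  simp_rw [hpt]
  rw [integral_const_mul, integral_tilt (blkIn p A) hAs hdet, secConst, condShift_eq_neg]
  simp only [sub_eq_add_neg]
  ring

/-- Integrability of the section weight `x ↦ e^{−½⟨φ,Aφ⟩}e^{⟨f,φ⟩}·a·c` (`A` positive definite). [folklore] [cite: Balaban1982Higgs2, (2.28) p.563] -/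
theorem integrable_section_const (hA : A.PosDef) (y : Out p → ℝ) (a c : ℝ) :
    Integrable (fun x => weight A (glue p x y) * (source f (glue p x y) * a * c)) := by
  have hAs : A.IsSymm := by
    have h := hA.isHermitian.eq
    rwa [conjTranspose_eq_transpose_of_trivial] at h
  have hIn : (blkIn p A).PosDef := by
    unfold blkIn
    exact hA.submatrix Subtype.val_injective
  have hpt : ∀ x, weight A (glue p x y) * (source f (glue p x y) * a * c)
      = (a * c * Real.exp (cOut p A f y))
        * Real.exp (-(jIn p A f y ⬝ᵥ x) - 1 / 2 * (x ⬝ᵥ (blkIn p A *ᵥ x))) := by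
    intro x
    have h := weight_mul_source_glue p A f hAs x y
    calc weight A (glue p x y) * (source f (glue p x y) * a * c)
        = (weight A (glue p x y) * source f (glue p x y)) * a * c := by ring
      _ = _ := by rw [h]; ring
  simp_rw [hpt]
  exact (integrable_tilt hIn _).const_mul _

end Conditioning

/-! ## §5 THE MODEL of (2.28) and the theorem -/

section Model

variable [DecidableEq S] (A : Matrix S S ℝ) (f : S → ℝ)

/-- `∫dμ_{A_Λ⁻¹}(φ′) F(φ′ + shift)` as a function of the exterior field `y = φ↾_{Λᶜ}`: the inner integral of the
right side of (2.28). [cite: Balaban1982Higgs2, (2.28) p.563] -/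
noncomputable def inner (F₀ : (In p → ℝ) → ℝ) (y : Out p → ℝ) : ℝ :=
  ∫ x, F₀ (x + condShift p A f y) ∂(gaussProb (blkIn p A))

/-- The inner integral written against Lebesgue measure. [folklore] [cite: Balaban1982Higgs2, (2.28) p.563] -/
theorem inner_eq (F₀ : (In p → ℝ) → ℝ) (y : Out p → ℝ) :
    inner p A f F₀ y = (gaussNorm (blkIn p A))⁻¹
      * ∫ z, gaussWeight (blkIn p A) z * F₀ (z + condShift p A f y) :=
  integral_gaussProb_eq _ _

/-- The inner integral as a normalised `gaussInt`. [folklore] [cite: Balaban1982Higgs2, (2.28) p.563] -/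
theorem inner_eq_gaussInt (F₀ : (In p → ℝ) → ℝ) (y : Out p → ℝ) :
    inner p A f F₀ y = (gaussNorm (blkIn p A))⁻¹ * gaussInt (blkIn p A) (fun z => F₀ (z + condShift p A f y)) := by
  rw [inner_eq]
  simp only [gaussInt, smul_eq_mul]

/-- The inner integral is a measurable function of the exterior field (`F` measurable). [folklore] [cite: Balaban1982Higgs2, (2.28) p.563] -/
theorem measurable_inner {F₀ : (In p → ℝ) → ℝ} (hF : Measurable F₀) : Measurable (inner p A f F₀) := by
  have h1 : inner p A f F₀ = fun y => (gaussNorm (blkIn p A))⁻¹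
      * ∫ z, gaussWeight (blkIn p A) z * F₀ (z + condShift p A f y) := funext fun y => inner_eq p A f F₀ y
  rw [h1]
  refine Measurable.const_mul ?_ _
  let g : (Out p → ℝ) × (In p → ℝ) → ℝ := fun r => gaussWeight (blkIn p A) r.2 * F₀ (r.2 + condShift p A f r.1)
  have hg : Measurable g :=
    ((show Measurable (gaussWeight (blkIn p A)) from measurable_gaussWeight_real _).comp measurable_snd).mul
      (hF.comp (measurable_snd.add ((continuous_condShift p A f).measurable.comp measurable_fst)))
  exact (hg.stronglyMeasurable.integral_prod_right' (ν := volume)).measurable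

/-- `|∫dμ F(· + μ)| · ∫dz e^{−½⟨z,A_Λz⟩} ≤ ∫dz e^{−½⟨z,A_Λz⟩}|F(z + μ)|`. [folklore] [cite: Balaban1982Higgs2, (2.28) p.563] -/
theorem abs_inner_mul_gaussNorm_le (F₀ : (In p → ℝ) → ℝ) (y : Out p → ℝ) (hN : gaussNorm (blkIn p A) ≠ 0) :
    |inner p A f F₀ y| * gaussNorm (blkIn p A)
      ≤ gaussInt (blkIn p A) (fun z => |F₀ (z + condShift p A f y)|) := by
  rw [inner_eq_gaussInt, abs_mul, abs_inv, abs_of_nonneg (gaussNorm_nonneg _), mul_comm, ← mul_assoc,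
    mul_inv_cancel₀ hN, one_mul]
  simp only [gaussInt, smul_eq_mul]
  refine (abs_integral_le_integral_abs).trans (le_of_eq ?_)
  refine integral_congr_ae (Filter.Eventually.of_forall fun z => ?_)
  simp only [abs_mul, abs_of_pos (gaussWeight_pos _ _)]

omit [Fintype S] [DecidableEq S] in
/-- Measurability of `q ↦ φ = (q.1 on Λ, q.2 on Λᶜ)`. [folklore] [cite: Balaban1982Higgs2, (2.28) p.563] -/
theorem measurable_glue : Measurable (fun q : (In p → ℝ) × (Out p → ℝ) => glue p q.1 q.2) := by
  have h : (fun q : (In p → ℝ) × (Out p → ℝ) => glue p q.1 q.2) = ⇑(splitEquiv p).symm :=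
    funext fun q => (splitEquiv_symm_apply p q).symm
  rw [h]
  exact (splitEquiv p).symm.measurable

/-- Integrability of the right-side integrand of (2.28) on pairs, from that of the left side. [folklore] [cite: Balaban1982Higgs2, (2.28) p.563] -/
theorem integrable_rhs (hA : A.PosDef) {F₀ : (In p → ℝ) → ℝ} {G₀ : (Out p → ℝ) → ℝ}
    (hF : Measurable F₀) (hG : Measurable G₀)
    (hΦ : Integrable (fun q : (In p → ℝ) × (Out p → ℝ) =>
      weight A (glue p q.1 q.2) * (source f (glue p q.1 q.2) * F₀ q.1 * G₀ q.2))) :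
    Integrable (fun q : (In p → ℝ) × (Out p → ℝ) =>
      weight A (glue p q.1 q.2) * (source f (glue p q.1 q.2) * G₀ q.2 * inner p A f F₀ q.2)) := by
  have hAs : A.IsSymm := by
    have h := hA.isHermitian.eq
    rwa [conjTranspose_eq_transpose_of_trivial] at h
  have hIn : (blkIn p A).PosDef := by
    unfold blkIn
    exact hA.submatrix Subtype.val_injective
  have hdet : IsUnit (blkIn p A).det := isUnit_iff_ne_zero.2 hIn.det_pos.ne'
  have hN : gaussNorm (blkIn p A) ≠ 0 := (gaussNorm_pos hIn).ne'
  -- measurability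
  have hgl := measurable_glue p
  have hW : Measurable fun q : (In p → ℝ) × (Out p → ℝ) => weight A (glue p q.1 q.2) :=
    (continuous_weight A).measurable.comp hgl
  have hS : Measurable fun q : (In p → ℝ) × (Out p → ℝ) => source f (glue p q.1 q.2) :=
    (continuous_source f).measurable.comp hgl
  have hI : Measurable (inner p A f F₀) := measurable_inner p A f hF
  have hmeas : AEStronglyMeasurable (fun q : (In p → ℝ) × (Out p → ℝ) =>
      weight A (glue p q.1 q.2) * (source f (glue p q.1 q.2) * G₀ q.2 * inner p A f F₀ q.2)) volume :=
    (hW.mul ((hS.mul (hG.comp measurable_snd)).mul (hI.comp measurable_snd))).aestronglyMeasurable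
  refine (integrable_prod_iff' hmeas).2 ⟨Filter.Eventually.of_forall fun y => ?_, ?_⟩
  · exact integrable_section_const p A f hA y (G₀ y) (inner p A f F₀ y)
  · -- the y-integral of the x-norm-integral is dominated by that of the left-side integrand
    have hdom := hΦ.integral_norm_prod_right
    have hclosed : ∀ y, (∫ x, ‖weight A (glue p x y) * (source f (glue p x y) * G₀ y * inner p A f F₀ y)‖)
        = |inner p A f F₀ y| * secConst p A f y * (gaussNorm (blkIn p A) * |G₀ y|) := by
      intro y
      have hpt : ∀ x, ‖weight A (glue p x y) * (source f (glue p x y) * G₀ y * inner p A f F₀ y)‖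
          = weight A (glue p x y) * (source f (glue p x y) * |G₀ y| * |inner p A f F₀ y|) := by
        intro x
        rw [Real.norm_eq_abs, abs_mul, abs_mul, abs_mul, abs_of_pos (weight_pos A _), abs_of_pos (source_pos f _)]
      simp_rw [hpt]
      rw [integral_section p A f hAs hdet y (fun _ => |G₀ y|) (|inner p A f F₀ y|)]
      simp only [gaussInt, smul_eq_mul, integral_mul_const, gaussNorm]
    have hclosedΦ : ∀ y, (∫ x, ‖weight A (glue p x y) * (source f (glue p x y) * F₀ x * G₀ y)‖)
        = |G₀ y| * secConst p A f y * gaussInt (blkIn p A) (fun z => |F₀ (z + condShift p A f y)|) := by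
      intro y
      have hpt : ∀ x, ‖weight A (glue p x y) * (source f (glue p x y) * F₀ x * G₀ y)‖
          = weight A (glue p x y) * (source f (glue p x y) * |F₀ x| * |G₀ y|) := by
        intro x
        rw [Real.norm_eq_abs, abs_mul, abs_mul, abs_mul, abs_of_pos (weight_pos A _), abs_of_pos (source_pos f _)]
      simp_rw [hpt]
      rw [integral_section p A f hAs hdet y (fun x => |F₀ x|) (|G₀ y|)]
    refine Integrable.mono' hdom ?_ (Filter.Eventually.of_forall fun y => ?_)
    · have hc : Measurable fun y => |inner p A f F₀ y| * secConst p A f y * (gaussNorm (blkIn p A) * |G₀ y|) := by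
        have hK : Measurable (secConst p A f) := by
          refine Continuous.measurable ?_
          unfold secConst cOut jIn
          fun_prop
        exact ((hI.abs).mul hK).mul ((hG.abs).const_mul _)
      exact hc.aestronglyMeasurable.congr (Filter.Eventually.of_forall fun y => (hclosed y).symm)
    · rw [Real.norm_eq_abs, abs_of_nonneg (integral_nonneg fun x => norm_nonneg _), hclosed y, hclosedΦ y]
      have h1 := abs_inner_mul_gaussNorm_le p A f F₀ y hN
      have hK : 0 ≤ secConst p A f y := (secConst_pos p A f y).le
      have hG0 : 0 ≤ |G₀ y| := abs_nonneg _
      calc |inner p A f F₀ y| * secConst p A f y * (gaussNorm (blkIn p A) * |G₀ y|)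
          = |G₀ y| * secConst p A f y * (|inner p A f F₀ y| * gaussNorm (blkIn p A)) := by ring
        _ ≤ |G₀ y| * secConst p A f y * gaussInt (blkIn p A) (fun z => |F₀ (z + condShift p A f y)|) :=
          mul_le_mul_of_nonneg_left h1 (mul_nonneg hG0 hK)

/-- **(2.28) for the finite-dimensional Gaussian model, explicit form.**  For `A` positive definite on the configurations
over the finite set `Ω` (= `S`), `Λ ⊂ Ω` (= `{s | p s}`), a source `f`, and measurable `F` (of `φ↾_Λ`), `G` (of `φ↾_{Λᶜ}`)
with `e^{−½⟨φ,Aφ⟩}e^{⟨f,φ⟩}F(φ↾_Λ)G(φ↾_{Λᶜ})` integrable: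
`∫Π_{x∈Ω}dφ(x) e^{−½⟨φ,Aφ⟩}e^{⟨f,φ⟩}F(φ↾_Λ)G(φ↾_{Λᶜ}) = ∫Π_{x∈Ω}dφ(x) e^{−½⟨φ,Aφ⟩}e^{⟨f,φ⟩}G(φ↾_{Λᶜ}) ·
∫dμ_{A_Λ⁻¹}(φ′)F(φ′ − A_Λ⁻¹Aφ↾_{Λᶜ} + A_Λ⁻¹f)`.  PROOF (the print's "conditional integration with conditioning on Λᶜ"):
Fubini over `φ = (φ↾_Λ, φ↾_{Λᶜ})`, completion of the square in `φ↾_Λ` at fixed `φ↾_{Λᶜ}` (`weight_mul_source_glue` =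
`B2.completeSquare228` exponentiated) and translation invariance of `dφ↾_Λ` (`integral_section`); the integrability of
the right side follows from that of the left side (`integrable_rhs`). [cite: Balaban1982Higgs2, (2.28) p.563] -/
theorem integral_conditioning (hA : A.PosDef) {F₀ : (In p → ℝ) → ℝ} {G₀ : (Out p → ℝ) → ℝ}
    (hF : Measurable F₀) (hG : Measurable G₀)
    (hint : Integrable fun φ : S → ℝ => weight A φ * (source f φ * F₀ (resIn p φ) * G₀ (resOut p φ))) :
    ∫ φ, weight A φ * (source f φ * F₀ (resIn p φ) * G₀ (resOut p φ))
      = ∫ φ, weight A φ * (source f φ * G₀ (resOut p φ) * inner p A f F₀ (resOut p φ)) := by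
  have hAs : A.IsSymm := by
    have h := hA.isHermitian.eq
    rwa [conjTranspose_eq_transpose_of_trivial] at h
  have hIn : (blkIn p A).PosDef := by
    unfold blkIn
    exact hA.submatrix Subtype.val_injective
  have hdet : IsUnit (blkIn p A).det := isUnit_iff_ne_zero.2 hIn.det_pos.ne'
  have hN : gaussNorm (blkIn p A) ≠ 0 := (gaussNorm_pos hIn).ne'
  -- the two integrands, read on pairs (φ↾_Λ, φ↾_{Λᶜ})
  set Φ : (In p → ℝ) × (Out p → ℝ) → ℝ :=
    fun q => weight A (glue p q.1 q.2) * (source f (glue p q.1 q.2) * F₀ q.1 * G₀ q.2) with hΦdef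
  set Ψ : (In p → ℝ) × (Out p → ℝ) → ℝ :=
    fun q => weight A (glue p q.1 q.2) * (source f (glue p q.1 q.2) * G₀ q.2 * inner p A f F₀ q.2) with hΨdef
  have eL : (∫ φ, weight A φ * (source f φ * F₀ (resIn p φ) * G₀ (resOut p φ))) = ∫ q, Φ q := by
    rw [integral_eq_integral_glue p]
    simp only [hΦdef, resIn_glue, resOut_glue]
  have eR : (∫ φ, weight A φ * (source f φ * G₀ (resOut p φ) * inner p A f F₀ (resOut p φ))) = ∫ q, Ψ q := by
    rw [integral_eq_integral_glue p]
    simp only [hΨdef, resOut_glue]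
  have hΦ : Integrable Φ := by
    have h := (integrable_iff_integrable_glue p _).1 hint
    simpa only [hΦdef, resIn_glue, resOut_glue] using h
  have hΨ : Integrable Ψ := integrable_rhs p A f hA hF hG hΦ
  rw [eL, eR]
  calc ∫ q, Φ q = ∫ y, ∫ x, Φ (x, y) := integral_prod_symm Φ hΦ
    _ = ∫ y, ∫ x, Ψ (x, y) := by
        refine integral_congr_ae (Filter.Eventually.of_forall fun y => ?_)
        show ∫ x, Φ (x, y) = ∫ x, Ψ (x, y)
        simp only [hΦdef, hΨdef]
        rw [integral_section p A f hAs hdet y F₀ (G₀ y),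
          integral_section p A f hAs hdet y (fun _ => G₀ y) (inner p A f F₀ y), inner_eq_gaussInt]
        have hc : gaussInt (blkIn p A) (fun _ : In p → ℝ => G₀ y) = gaussNorm (blkIn p A) * G₀ y := by
          simp only [gaussInt, smul_eq_mul, integral_mul_const, gaussNorm]
        rw [hc]
        field_simp
    _ = ∫ q, Ψ q := (integral_prod_symm Ψ hΨ).symm

omit [DecidableEq S] in
/-- `(Aφ↾_{Λᶜ})↾_Λ = A_{ΛΛᶜ}(φ↾_{Λᶜ})`. [folklore] [cite: Balaban1982Higgs2, (2.28) p.563] -/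
theorem resIn_mulVec_glue_zero (y : Out p → ℝ) : resIn p (A *ᵥ glue p 0 y) = blkMix p A *ᵥ y := by
  funext i
  rw [resIn, mulVec_glue_in]
  simp

/-- **THE CONCRETE CARRIER OF (2.28).**  Print: *"Let Ω be a finite set, Λ ⊂ Ω, and let A be a positive operator on a
space of field configurations on Ω, A_Λ its restriction on Λ"*; here `Ω` ↦ the finite type `S`, `Λ` ↦ `{s | p s}` for a
decidable predicate `p` (`Λ := univ.filter p`), configurations `φ : S → ℝ`, `A : Matrix S S ℝ`; `F(φ↾_Λ)` ↦ `F₀ (resIn p φ)`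
and `G(φ↾_{Λᶜ})` ↦ `G₀ (resOut p φ)` for `F₀ : (Λ → ℝ) → ℝ`, `G₀ : (Λᶜ → ℝ) → ℝ`; the printed functionals:
`∫Π_{x∈Ω}dφ(x) exp(−½⟨φ,Aφ⟩)(·)` ↦ the Lebesgue (Bochner) integral against `weight A`; `∫dμ_{A_Λ⁻¹}(φ′)(·)` ↦
integration against the probability measure `gaussProb (blkIn p A)` of configurations `φ′` on `Λ` (extended by `0` to
`Ω`); the shift `−A_Λ⁻¹Aφ↾_{Λᶜ} + A_Λ⁻¹f` ↦ literally `A_Λ⁻¹(f↾_Λ − (A(φ↾_{Λᶜ}))↾_Λ)` extended by `0`.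
[cite: Balaban1982Higgs2, (2.28) p.563] -/
noncomputable def model (F₀ : (In p → ℝ) → ℝ) (G₀ : (Out p → ℝ) → ℝ) : B2.CondSetting S where
  Λ := Finset.univ.filter p
  A := A
  f := f
  F := fun φ => F₀ (resIn p φ)
  G := fun φ => G₀ (resOut p φ)
  gaussInt := fun h => ∫ φ, weight A φ * h φ
  condInt := fun h => ∫ x, h (glue p x 0) ∂(gaussProb (blkIn p A))
  shift := fun φ => glue p ((blkIn p A)⁻¹ *ᵥ (resIn p f - resIn p (A *ᵥ glue p 0 (resOut p φ)))) 0

/-- The model's shift is the printed configuration `μ(φ↾_{Λᶜ})` on `Λ`, zero on `Λᶜ`. [cite: Balaban1982Higgs2, (2.28) p.563] -/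
theorem model_shift (F₀ : (In p → ℝ) → ℝ) (G₀ : (Out p → ℝ) → ℝ) (φ : S → ℝ) :
    (model p A f F₀ G₀).shift φ = glue p (condShift p A f (resOut p φ)) 0 := by
  simp only [model, condShift, resIn_mulVec_glue_zero]

/-- The model's inner integrand: `F((φ′ + shift φ)↾_Λ) = F₀(x + μ(φ↾_{Λᶜ}))` for `φ′ = x` extended by `0`.
[cite: Balaban1982Higgs2, (2.28) p.563] -/
theorem model_condInt (F₀ : (In p → ℝ) → ℝ) (G₀ : (Out p → ℝ) → ℝ) (φ : S → ℝ) :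
    (model p A f F₀ G₀).condInt (fun φ' => (model p A f F₀ G₀).F (φ' + (model p A f F₀ G₀).shift φ))
      = inner p A f F₀ (resOut p φ) := by
  rw [model_shift]
  simp only [model, inner, ← glue_add, add_zero, resIn_glue]

/-- **(2.28) p. 563 PROVED for the concrete model**: the typed display `B2.Display228` holds for the carrier `model p A f
F₀ G₀` whenever `A` is positive definite, `F₀`, `G₀` are measurable and the left side is an absolutely convergent integral
(the print's standing finite-dimensional setting: *"Then we have (2.28), where dμ_{A_Λ⁻¹} is a probabilistic Gaussian
measure with the covariance A_Λ⁻¹"*). [cite: Balaban1982Higgs2, (2.28) p.563] -/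
theorem display228 (hA : A.PosDef) {F₀ : (In p → ℝ) → ℝ} {G₀ : (Out p → ℝ) → ℝ}
    (hF : Measurable F₀) (hG : Measurable G₀)
    (hint : Integrable fun φ : S → ℝ =>
      Real.exp (-(1/2 : ℝ) * (φ ⬝ᵥ A *ᵥ φ)) * (Real.exp (∑ s, f s * φ s) * F₀ (resIn p φ) * G₀ (resOut p φ))) :
    B2.Display228 (model p A f F₀ G₀) := by
  have key := integral_conditioning p A f hA hF hG hint
  unfold B2.Display228
  simp only [model_condInt]
  simp only [model, weight, source] at key ⊢
  exact key

/-! ## §6 All hypotheses discharged for bounded measurable `F`, `G` (characteristic functions × bounded densities) -/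

/-- `e^{−½⟨φ,Aφ⟩}e^{⟨f,φ⟩}` is integrable over the configurations on `Ω` (`A` positive definite). [folklore] [cite: Balaban1982Higgs2, (2.28) p.563] -/
theorem integrable_weight_mul_source (hA : A.PosDef) : Integrable fun φ : S → ℝ => weight A φ * source f φ := by
  have h := integrable_tilt hA (-f)
  refine h.congr (Filter.Eventually.of_forall fun φ => ?_)
  show Real.exp (-(-f ⬝ᵥ φ) - 1 / 2 * (φ ⬝ᵥ (A *ᵥ φ))) = weight A φ * source f φ
  rw [weight, source, ← Real.exp_add, neg_dotProduct, neg_neg, dotProduct]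
  congr 1
  ring

omit [Fintype S] [DecidablePred p] [DecidableEq S] in
/-- Restriction to `Λ` is measurable. [folklore] [cite: Balaban1982Higgs2, (2.28) p.563] -/
theorem measurable_resIn : Measurable (resIn p : (S → ℝ) → In p → ℝ) :=
  measurable_pi_lambda _ fun i => measurable_pi_apply (i : S)

omit [Fintype S] [DecidablePred p] [DecidableEq S] in
/-- Restriction to `Λᶜ` is measurable. [folklore] [cite: Balaban1982Higgs2, (2.28) p.563] -/
theorem measurable_resOut : Measurable (resOut p : (S → ℝ) → Out p → ℝ) :=
  measurable_pi_lambda _ fun j => measurable_pi_apply (j : S)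

/-- For BOUNDED measurable `F`, `G` the left side of (2.28) converges absolutely, so (2.28) holds with no further
hypothesis (the case of the print's application, p. 563: `F = χ′exp(V⁽⁰⁾(Λ₇))`, `G` = characteristic functions × the remaining
exponential factors). [cite: Balaban1982Higgs2, (2.28) p.563] -/
theorem display228_of_bounded (hA : A.PosDef) {F₀ : (In p → ℝ) → ℝ} {G₀ : (Out p → ℝ) → ℝ}
    (hF : Measurable F₀) (hG : Measurable G₀) {CF CG : ℝ} (hFb : ∀ x, |F₀ x| ≤ CF) (hGb : ∀ y, |G₀ y| ≤ CG) :
    B2.Display228 (model p A f F₀ G₀) := by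
  refine display228 p A f hA hF hG ?_
  have hws := integrable_weight_mul_source A f hA
  have hm : AEStronglyMeasurable (fun φ : S → ℝ => F₀ (resIn p φ) * G₀ (resOut p φ)) volume :=
    ((hF.comp (measurable_resIn p)).mul (hG.comp (measurable_resOut p))).aestronglyMeasurable
  have hCF : 0 ≤ CF := (abs_nonneg _).trans (hFb 0)
  have hb : ∀ᵐ φ : S → ℝ ∂volume, ‖F₀ (resIn p φ) * G₀ (resOut p φ)‖ ≤ CF * CG :=
    Filter.Eventually.of_forall fun φ => by
      rw [Real.norm_eq_abs, abs_mul]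
      exact mul_le_mul (hFb _) (hGb _) (abs_nonneg _) hCF
  have h := hws.bdd_mul hm hb
  refine h.congr (Filter.Eventually.of_forall fun φ => ?_)
  show F₀ (resIn p φ) * G₀ (resOut p φ) * (weight A φ * source f φ) = _
  rw [weight, source]
  ring

/-! ## §7 The shift for a nearest-neighbour coupling: (2.29)/(2.30) p. 563 (members of SKELETON row B2.Eq2.42) -/

/-- The shift written through the boundary couplings: if `A` couples `Λ` to `Λᶜ` only through a finite set `st` of pairs
`b = (b₋, b₊)`, `b₋ ∈ Λ`, `b₊ ∈ Λᶜ` (print: *"st(Λ₅)"*, the bonds crossing `∂Λ₅`), then at source `f = 0`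
`(φ′ − A_Λ⁻¹Aφ↾_{Λᶜ})(x) = φ′(x) + Σ_{b∈st} A_Λ⁻¹(x, b₋)·(−A(b₋,b₊))·φ(b₊)`, `x ∈ Λ`. [cite: Balaban1982Higgs2, (2.29)–(2.30) p.563] -/
theorem shift_eq_sum_boundary (st : Finset (In p × Out p)) (hst : ∀ i j, (i, j) ∉ st → blkMix p A i j = 0)
    (x : In p → ℝ) (y : Out p → ℝ) (i : In p) :
    (x + condShift p A 0 y) i = x i + ∑ b ∈ st, (blkIn p A)⁻¹ i b.1 * (-(blkMix p A b.1 b.2)) * y b.2 := by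
  -- the double sum over (i', j) ∈ Λ × Λᶜ is supported on `st`
  have hsum : ∀ C : In p → ℝ,
      ∑ i', C i' * ∑ j, blkMix p A i' j * y j = ∑ b ∈ st, C b.1 * (blkMix p A b.1 b.2 * y b.2) := by
    intro C
    calc ∑ i', C i' * ∑ j, blkMix p A i' j * y j
        = ∑ i', ∑ j, C i' * (blkMix p A i' j * y j) := by simp_rw [Finset.mul_sum]
      _ = ∑ b : In p × Out p, C b.1 * (blkMix p A b.1 b.2 * y b.2) :=
          (Fintype.sum_prod_type' (fun i' j => C i' * (blkMix p A i' j * y j))).symm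
      _ = ∑ b ∈ st, C b.1 * (blkMix p A b.1 b.2 * y b.2) := by
          refine (Finset.sum_subset (Finset.subset_univ st) fun b _ hb => ?_).symm
          rw [hst b.1 b.2 hb, zero_mul, mul_zero]
  have h0 : resIn p (0 : S → ℝ) - blkMix p A *ᵥ y = -(blkMix p A *ᵥ y) := by
    funext i'
    simp [resIn]
  rw [Pi.add_apply, condShift, h0, mulVec_neg, Pi.neg_apply, mulVec, dotProduct]
  simp only [mulVec, dotProduct]
  rw [hsum, ← Finset.sum_neg_distrib]
  congr 1
  exact Finset.sum_congr rfl fun b _ => by ring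

/-- **(2.29)** p. 563 (vector fields; the same display with `U(B_b^{(1)})` in place of `1` is **(2.30)**, scalar fields):
for the unit-lattice coupling `A(b₋, b₊) = −1` across the bonds `b ∈ st(Λ₅)` (and no other coupling between `Λ₅` and
`Λ₅ᶜ`), *"The expression (φ′ − A_Λ⁻¹Aφ↾_{Λᶜ})(x) for vector fields has the form A′(x) + Σ_{b∈st(Λ₅)} C⁽⁰⁾_{Λ₅}(x, b₋)A′(b₊),
x ∈ Λ₅"* with `C⁽⁰⁾_{Λ₅} = A_{Λ₅}⁻¹`. [cite: Balaban1982Higgs2, (2.29) p.563] -/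
theorem display229 (st : Finset (In p × Out p)) (hst : ∀ i j, (i, j) ∉ st → blkMix p A i j = 0)
    (hunit : ∀ b ∈ st, blkMix p A b.1 b.2 = -1) (x : In p → ℝ) (y : Out p → ℝ) (i : In p) :
    (x + condShift p A 0 y) i = x i + ∑ b ∈ st, (blkIn p A)⁻¹ i b.1 * y b.2 := by
  rw [shift_eq_sum_boundary p A st hst x y i]
  congr 1
  refine Finset.sum_congr rfl fun b hb => ?_
  rw [hunit b hb, neg_neg, mul_one]

end Model
end Literature.MathematicalPhysics.QuantumFieldTheory.Balaban1983to89.B2Eq228Conditioning
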